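import Mathlib
import HarnessLib
import Summits.NavierStokesRegularity.NavierStokesRegularity.Theorems.TaylorModelRungThreeCertificateStageNumerics

/-!
# Crux K1b-DR (stmt-NavierStokesRegularity-23954), line `taylor-model` — the executable checker of the
# `Static` block of `CertData.Valid` (CERT-CONTRACT-23954 v1 §4 STATIC), format of record p602753

The `Static` block of `TaylorChain.CertData.Valid` (TaylorChainCertificate.lean, `CertData.Static`) consists of the
closed-form design clauses of the crux: `1 ≤ R`, the table class `InTableClass R α` (symmetry (4.2), cancellation
(4.3), `R`-comparability of the structure constants on Tao's shift set), `X₀ i₀ ≠ 0`, the scalar ranges of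
`θ, c, η₀, Cb, Cg, Kb, Ka, τs, mm`, positivity of the shell envelopes `M`, `W` on the window, the three power
inequalities (with `2^(-7(Kb+1)/4)`, `2^(-5(Kb+1)/2)`, `√Cg`, `2^(6Ka)`, `2^(Ka+2)`), the SLACK-SERIES clause
`∀ L k, 2·slackWeight 1 θ c env L k + (c·4^k + 1)·M_k² ≤ W_k` (uniform in the number `L` of past epochs), and the datum
clause `|ℓ 0 l (datumState i₀ X₀) − ctr 0 l| ≤ rad 0 l − s 0 l`.

This module is the Boolean checker `checkStatic T B` of that block over the tables `TaylorModelCert.CertTables K` of the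
format of record (window envelopes `Mw`/`Ww` from `…CertificateStageNumerics`) plus a small record `StaticAux K` of one-sided SURROGATES for the irrational constants (each certified
by an exact check in `K`, `checkStaticAux`): `u1 ≥ 2^(-7(Kb+1)/4)`, `u2 ≥ 2^(-5(Kb+1)/2)`, `gLo ≤ √Cg ≤ gHi`, and
`q52 ≥ 2^(5/2+θ)` with `q52 < 2^7` (the ratio of the geometric tail of the slack series). The slack series is
majorised UNIFORMLY IN `L` by the closed form `slackK`: window part `Σ_{d=1}^{Ka-k} q52^d (M_{k+d}²/2 + W_{k+d})` plus the
tail `5·Cg·2^(-7k)·ρ^(Ka-k+1)/(1-ρ)`, `ρ = q52/2^7` (behind-window shells never occur in `env (k+d)`, `d ≥ 1`). The table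
class is checked as `4·64` exact identities / comparisons on the `α` table with the five permutation index maps of the
shift set. SOUNDNESS (`Static` of `toCertData φ T` from `checkStatic = true`) is proved in `…CertificateStaticSound*`;
this file asserts nothing.

MODEL-lattice bookkeeping only (rung TL-M3, Tao-type averaged cascade); nothing here is a statement about the Navier–Stokes
equations.
-/

-- the sub-problem namespace repeats the summit name by design (D-0017)
set_option linter.dupNamespace false

namespace Summit.NavierStokesRegularity.NavierStokesRegularity.Theorems.TaylorModelCert

open scoped BigOperators
open Literature.Analysis.FluidPDE.TaoCascade Literature.Analysis.FluidPDE.TaoCascade.TaylorChain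

/-- Auxiliary SURROGATE data for the `Static` checker: `θ = θnum/θden`; UPPER surrogates `u1 ≥ 2^(-7(Kb+1)/4)`
(certified by `1 ≤ u1⁴·2^(7(Kb+1))`), `u2 ≥ 2^(-5(Kb+1)/2)` (`1 ≤ u2²·2^(5(Kb+1))`); `gLo ≤ √Cg` (`gLo² ≤ Cg`) and
`gHi ≥ √Cg` (`Cg ≤ gHi²`); `q52 ≥ 2^(5/2+θ)` (`2^(5·θden+2·θnum) ≤ q52^(2·θden)`), all nonnegative. [folklore] -/
structure StaticAux (K : Type) where
  (θnum θden : ℕ)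
  (u1 u2 gLo gHi q52 : K)

/-! ### Permutation index maps of the shift set `S = [(0,0,0),(1,0,0),(0,1,0),(0,0,1)]` -/

/-- Index of `(μ₁, μ₃, μ₂)` from the index of `(μ₁, μ₂, μ₃)`. [folklore] -/
def p132 (μi : ℕ) : ℕ := if μi = 2 then 3 else if μi = 3 then 2 else μi

/-- Index of `(μ₂, μ₁, μ₃)`. [folklore] -/
def p213 (μi : ℕ) : ℕ := if μi = 1 then 2 else if μi = 2 then 1 else μi

/-- Index of `(μ₂, μ₃, μ₁)`. [folklore] -/
def p231 (μi : ℕ) : ℕ := if μi = 1 then 3 else if μi = 2 then 1 else if μi = 3 then 2 else μi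

/-- Index of `(μ₃, μ₁, μ₂)`. [folklore] -/
def p312 (μi : ℕ) : ℕ := if μi = 1 then 2 else if μi = 2 then 3 else if μi = 3 then 1 else μi

/-- Index of `(μ₃, μ₂, μ₁)`. [folklore] -/
def p321 (μi : ℕ) : ℕ := if μi = 1 then 3 else if μi = 3 then 1 else μi

namespace CertTables

variable {K : Type} [Field K] [LinearOrder K]

/-- Structure-table entry `α(a, b, i, μi)` (indices as naturals `< 4`). [folklore] -/
def αt (T : CertTables K) (a b i μi : ℕ) : K := vget T.α (((a * 4 + b) * 4 + i) * 4 + μi)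

/-! ### Certification of the surrogates -/

/-- Exact certification of `StaticAux` against the global tables (plus `0 ≤ Kb`, `1 ≤ Ka`, `0 ≤ Cg`, `q52 < 2^7`).
[folklore] -/
def checkStaticAux (T : CertTables K) (B : StaticAux K) : Bool :=
  decide (0 ≤ T.Kb) && decide (1 ≤ T.Ka) && decide (0 ≤ T.Cg) &&
  decide (0 < B.θden) && decide (T.θ * ((B.θden : ℕ) : K) = ((B.θnum : ℕ) : K)) &&
  decide (0 ≤ B.u1) && decide (1 ≤ B.u1 ^ 4 * (2 : K) ^ (7 * (T.Kb + 1).toNat)) &&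
  decide (0 ≤ B.u2) && decide (1 ≤ B.u2 ^ 2 * (2 : K) ^ (5 * (T.Kb + 1).toNat)) &&
  decide (0 ≤ B.gLo) && decide (B.gLo ^ 2 ≤ T.Cg) &&
  decide (0 ≤ B.gHi) && decide (T.Cg ≤ B.gHi ^ 2) &&
  decide (0 ≤ B.q52) && decide ((2 : K) ^ (5 * B.θden + 2 * B.θnum) ≤ B.q52 ^ (2 * B.θden)) &&
  decide (B.q52 < 2 ^ 7)

/-! ### The table class `InTableClass R α` as exact table checks -/

/-- Symmetry (4.2): `α(a,b,i,μ) = α(b,a,i,μ₂μ₁μ₃)`. [folklore] -/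
def checkSymm (T : CertTables K) : Bool :=
  allN 4 fun a => allN 4 fun b => allN 4 fun i => allN 4 fun μi =>
    decide (T.αt a b i μi = T.αt b a i (p213 μi))

/-- Cancellation (4.3): the six-term permutation sum vanishes. [folklore] -/
def checkCancel (T : CertTables K) : Bool :=
  allN 4 fun a => allN 4 fun b => allN 4 fun i => allN 4 fun μi =>
    decide (T.αt a b i μi + T.αt a i b (p132 μi) + T.αt b a i (p213 μi) + T.αt b i a (p231 μi) +
      T.αt i a b (p312 μi) + T.αt i b a (p321 μi) = 0)

/-- Comparability with spread `R`: `|α| ≤ 1` and `α = 0 ∨ 1 ≤ R·|α|`. [folklore] -/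
def checkCompar (T : CertTables K) : Bool :=
  allN 4 fun a => allN 4 fun b => allN 4 fun i => allN 4 fun μi =>
    decide (|T.αt a b i μi| ≤ 1) && (decide (T.αt a b i μi = 0) || decide (1 ≤ T.R * |T.αt a b i μi|))

/-! ### The slack-series majorant (uniform in `L`) -/

/-- Window part `Σ_{d=1}^{Ka-k} q52^d (M_{k+d}²/2 + W_{k+d})` at window index `kk` (`k = kk − Kb`). [folklore] -/
def slackWin (T : CertTables K) (B : StaticAux K) (kk : ℕ) : K :=
  sumN (T.m - 1 - kk) fun t => B.q52 ^ (t + 1) * (T.Mw (kk + t + 1) ^ 2 / 2 + T.Ww (kk + t + 1))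

/-- Tail part `5·Cg·2^(-7k)·ρ^(Ka-k+1)/(1-ρ)`, `ρ = q52/2^7`, at window index `kk`. [folklore] -/
def slackTail (T : CertTables K) (B : StaticAux K) (kk : ℕ) : K :=
  5 * T.Cg * (2 : K) ^ (-(7 * ((kk : ℤ) - T.Kb))) * (B.q52 / 2 ^ 7) ^ (T.m - kk) / (1 - B.q52 / 2 ^ 7)

/-- The closed-form majorant `slackK ≥ slackWeight 1 θ c env L k` for every `L`, at window index `kk`. [folklore] -/
def slackK (T : CertTables K) (B : StaticAux K) (kk : ℕ) : K :=
  T.c * (2 : K) ^ (2 * ((kk : ℤ) - T.Kb)) * (T.slackWin B kk + T.slackTail B kk)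

/-! ### The datum clause -/

/-- Window values of the rescaled one-shell datum `datumState i₀ X₀` (exact in `K`). [folklore] -/
def datumK (T : CertTables K) (c : ℕ) : K :=
  if c % T.m = T.Kb.toNat then vget T.X₀ (c / T.m % 4) / |vget T.X₀ T.i₀.val| else 0

/-- Number of face indices of stage `0` to test (beyond it every table entry involved is junk `0`). [folklore] -/
def nFaces0 (T : CertTables K) : ℕ :=
  max (max (T.stage 0).ell.length (T.stage 0).ctr.length) (max (T.stage 0).rad.length (T.stage 0).s.length)

/-- DATUM: `|Σ_c ell_{l,c}·datumK_c − ctr_l| ≤ rad_l − s_l` for every face `l < nFaces0`. [folklore] -/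
def checkDatum (T : CertTables K) : Bool :=
  allN T.nFaces0 fun l =>
    decide (|sumN T.n (fun c => vget ((T.stage 0).ell.getD l []) c * T.datumK c) - vget (T.stage 0).ctr l| ≤
      vget (T.stage 0).rad l - vget (T.stage 0).s l)

/-! ### The checker of the `Static` block -/

/-- SCALARS of `Static`: `1 ≤ R`, `X₀ i₀ ≠ 0`, the ranges of `θ, c, η₀, Cb, Cg, Kb, Ka, τs, mm`, `M > 0 ∧ W ≥ 0` on
the window, and the three power inequalities against the surrogates. [folklore] -/
def checkStaticScalars (T : CertTables K) (B : StaticAux K) : Bool :=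
  decide (1 ≤ T.R) && !decide (vget T.X₀ T.i₀.val = 0) &&
  decide (0 ≤ T.θ) && decide (T.θ < 1 / 2) && decide (0 < T.c) && decide (0 < T.η₀) && decide (T.η₀ ≤ 1) &&
  decide (0 < T.Cb) && decide (0 < T.Cg) && decide (0 ≤ T.Kb) && decide (1 ≤ T.Ka) && decide (0 < T.τs) &&
  decide (T.τs ≤ T.c) && decide (0 < T.mm) &&
  allN T.m (fun kk => decide (0 < T.Mw kk) && decide (0 ≤ T.Ww kk)) &&
  decide (T.c * (68 * T.Cb * B.u1 + 47 * T.Mw 0 * B.u2) ≤ 1 / 8) &&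
  decide (2560 * T.c * T.Mw (T.m - 1) ^ 2 * (2 : K) ^ (6 * T.Ka.toNat) ≤ B.gLo) &&
  decide (51200 * T.c * B.gHi ≤ (2 : K) ^ (T.Ka + 2).toNat)

/-- SLACK SERIES: `2·slackK + (c·4^k + 1)·M_k² ≤ W_k` for every window shell. [folklore] -/
def checkSlack (T : CertTables K) (B : StaticAux K) : Bool :=
  allN T.m fun kk =>
    decide (2 * T.slackK B kk + (T.c * (2 : K) ^ (2 * ((kk : ℤ) - T.Kb)) + 1) * T.Mw kk ^ 2 ≤ T.Ww kk)

/-- **The checker of the `Static` block.** [folklore] -/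
def checkStatic (T : CertTables K) (B : StaticAux K) : Bool :=
  T.checkStaticAux B && T.checkStaticScalars B && T.checkSymm && T.checkCancel && T.checkCompar &&
  T.checkSlack B && T.checkDatum

end CertTables

end Summit.NavierStokesRegularity.NavierStokesRegularity.Theorems.TaylorModelCert
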